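import Literature.AlgebraicGeometry.HodgeTheory.KunnethStandardConjectureSurjections
import Literature.AlgebraicGeometry.HodgeTheory.GysinExteriorProduct
import Literature.AlgebraicGeometry.HodgeTheory.DivisorCupRaisesGeometricConiveau
import Literature.AlgebraicGeometry.HodgeTheory.KunnethComponentsDiagonalAlgebraicPart
import HarnessLib

/-!
# The Künneth standard conjecture descends along morphisms of positive relative dimension with a
# relatively non-degenerate divisor class: `C(X) ⟹ C(W)`

Family `hodge`, layer `Literature/AlgebraicGeometry/HodgeTheory`; namespace
`Literature.AlgebraicGeometry.HodgeTheory`. Theorems only (no definition, no named fact, sorry-free).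

Kahn, Lemma 6.30 (2) ("`p^i_{M'}` is algebraic for every direct summand `M'` of `M`") in the geometric
situation of Kleiman's §1: let `g : X ⟶ W` be a morphism of smooth projective complex varieties,
`dim X = n = m + r`, `dim W = m`, and `η ∈ N¹H²(X(ℂ))` a divisor class whose `r`-th power has non-zero
degree on the fibres — `g_*(ηʳ) = c · 1_W`, `c ≠ 0` (for `r = 0`: `g` surjective, the file
`KunnethStandardConjectureSurjections`; for `r > 0`: e.g. `η` ample and `g` surjective). Then `h(W)` is
the direct summand of `h(X)` cut out by `c⁻¹ · Γ_g ∘ (ηʳ ∪ –) ∘ ᵗΓ_g`, and the Künneth components of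
`cl(Δ_W)` are `π_W i = c⁻¹ · (g ⊗ g)_*(pr₂^* ηʳ ∪ π_X i)`: push-forwards of the Künneth components of
`cl(Δ_X)` CUPPED WITH A POWER OF A DIVISOR CLASS — which stays algebraic UNCONDITIONALLY (the
divisor case of Voisin II Prop. 9.20 on the coniveau carrier, the tree's
`lefschetzPow_mem_supportedClasses_add`; no moving lemma).

* §1 `cupProduct_map_snd_mem_kunnethPiece`, `lefschetzPow_map_snd_mem_kunnethPiece` —
  `pr₂^* θ ∪ (Hʲ(X) ⊗ Hⁱ(Y)) ⊆ Hʲ(X) ⊗ H^{t+i}(Y)`, and its iterate for the Lefschetz operator of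
  `pr₂^* κ`.
* §2 `lefschetzPow_map_snd_complexGysin_diagonal` — `L^r_{pr₂^*η}(Δ_* z) = Δ_*(L^r_η z)` (projection
  formula for `Δ`, `Δ^* pr₂^* = id`); `complexGysin_tensorHom_complexGysin_diagonal` —
  `(g ⊗ g)_*(Δ_{X*} z) = Δ_{W*}(g_* z)`.
* §3 **`kunnethComponents_diagonalClass_lefschetzPow`** — for `g_*(L^r_η 1) = c · 1`, `c ≠ 0`, and a
  Künneth decomposition `π_X` of `cl(Δ_X)`, the classes `c⁻¹ · (g ⊗ g)_*(L^r_{pr₂^*η}(π_X i))`,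
  `i ≤ 2m`, form a Künneth decomposition of `cl(Δ_W)` (the members with `i > 2m` vanish:
  `H^{i+2r}(X(ℂ)) = 0`); **`kunnethComponent_diagonalClass_mem_algebraicClasses_of_lefschetzPow`** —
  **`C(X) ⟹ C(W)`** under this hypothesis (coniveau version `…_mem_supportedClasses_…` omitted: the
  cup with `ηʳ` raises the coniveau by `r` and `(g ⊗ g)_*` lowers the codimension by `2r`); the
  family-free form `…_of_forall`.

## References

* [Kahn2020] B. Kahn, Zeta and L-functions of varieties and motives, LMS LN 462, CUP 2020, §6.9
  Lemma 6.30 (2) and its proof.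
* [Kleiman1968AlgebraicCycles] S. Kleiman, Algebraic cycles and the Weil conjectures (1968), §1–§2.
* [VoisinHodgeII2003] C. Voisin, Hodge Theory and Complex Algebraic Geometry II, CUP 2003, §9.2.4
  Prop. 9.20, Prop. 9.21.
* [Voisin2025] C. Voisin, Hodge and generalized Hodge conjectures, coniveau and algebraic cycles,
  J. Open Math. Probl. 1 (2025), §4.3 and §3.2.1 (12)–(14).
* [Fulton1998] W. Fulton, Intersection Theory, 2nd ed., Springer 1998, §16.1 Prop. 16.1.1 (c),
  Prop. 1.10 (b) (i).
-/

noncomputable section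

open CategoryTheory AlgebraicGeometry MonoidalCategory CartesianMonoidalCategory Finset
open Literature.AlgebraicTopology.SingularHomology Literature.Geometry.Kaehler
open Literature.AlgebraicGeometry.Motives (IsSmoothProjective ComplexPoints)

namespace Literature.AlgebraicGeometry.HodgeTheory

variable {n m : ℕ} {X Y W : Motives.SchemeOver ℂ}

/-! ### §1 Cup product with a class pulled back from the second factor respects the Künneth pieces -/

/-- **`pr₂^* θ ∪ (Hʲ(X) ⊗ Hⁱ(Y)) ⊆ Hʲ(X) ⊗ H^{t+i}(Y)`**: `pr₂^* θ ∪ (pr₁^* a ∪ pr₂^* b) =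
± pr₁^* a ∪ pr₂^*(θ ∪ b)` (associativity and graded commutativity of `∪`, `pr₂^* θ ∪ pr₂^* b =
pr₂^*(θ ∪ b)`). [cite: HatcherAT2002, §3.2 Thm. 3.16 and Prop. 3.10] -/
theorem cupProduct_map_snd_mem_kunnethPiece {t i j k l i' : ℕ} {h : j + i = k}
    {w : complexBetti (X ⊗ Y) k} (hw : w ∈ kunnethPiece X Y h) (θ : complexBetti Y t) (hl : t + k = l)
    (h' : j + i' = l) (hi' : t + i = i') :
    cupProduct hl (complexBetti.map (snd X Y) t θ) w ∈ kunnethPiece X Y h' := by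
  subst hi'
  induction hw using Submodule.span_induction with
  | mem v hv =>
    obtain ⟨a, b, rfl⟩ := hv
    have hb : complexBetti.map (snd X Y) (t + i) (cupProduct rfl θ b) =
        cupProduct rfl (complexBetti.map (snd X Y) t θ) (complexBetti.map (snd X Y) i b) := by
      rw [complexBetti.map, cupProduct_map, ← complexBetti.map, ← complexBetti.map]
    rw [← cupProduct_assoc (rfl : t + j = t + j) h (show t + j + i = l by omega) hl,
      cupProduct_gradedComm_holds ℂ _ (rfl : t + j = t + j) (show j + t = t + j by omega)
        (complexBetti.map (snd X Y) t θ) (complexBetti.map (fst X Y) j a),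
      map_smul, LinearMap.smul_apply,
      cupProduct_assoc (show j + t = t + j by omega) (rfl : t + i = t + i) (show t + j + i = l by omega) h',
      ← hb]
    exact Submodule.smul_mem _ _ (cupProduct_fst_snd_mem_kunnethPiece h' a _)
  | zero => rw [LinearMap.map_zero]; exact Submodule.zero_mem _
  | add v v' _ _ hv hv' => rw [LinearMap.map_add]; exact Submodule.add_mem _ hv hv'
  | smul c v _ hv => rw [LinearMap.map_smul]; exact Submodule.smul_mem _ c hv

/-- **The iterated Lefschetz operator of `pr₂^* κ` maps `Hʲ(X) ⊗ Hⁱ(Y)` into `Hʲ(X) ⊗ H^{i+2r}(Y)`.**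
[cite: HatcherAT2002, §3.2 Thm. 3.16] [cite: VoisinHodgeI2002, §6.2.3] -/
theorem lefschetzPow_map_snd_mem_kunnethPiece (κ : complexBetti Y 2) {i j k : ℕ} {h : j + i = k}
    {w : complexBetti (X ⊗ Y) k} (hw : w ∈ kunnethPiece X Y h) (r : ℕ) {i' : ℕ}
    (h' : j + i' = k + 2 * r) (hi' : i + 2 * r = i') :
    lefschetzPow (complexBetti.map (snd X Y) 2 κ) r k w ∈ kunnethPiece X Y h' := by
  subst hi'
  induction r with
  | zero => simpa using hw
  | succ r ih =>
    rw [lefschetzPow_succ, LinearMap.comp_apply, lefschetzOperator_apply]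
    exact cupProduct_map_snd_mem_kunnethPiece (ih (by omega)) κ _ h' (by omega)

/-! ### §2 The Lefschetz operator of `pr₂^* η` on `Δ_* z`, and `(g ⊗ g)_* Δ_*` -/

/-- **`L^r_{pr₂^*η}(Δ_* z) = Δ_*(L^r_η z)`** for a degree-`0` class `z` (e.g. `z = 1`, `Δ_* 1 = cl(Δ)`): by
the projection formula `pr₂^* η ∪ Δ_* y = Δ_*(Δ^* pr₂^* η ∪ y) = Δ_*(η ∪ y)`, iterated.
[cite: FultonYoungTableaux1997, Appendix B §B.1 (6)] [cite: Fulton1998, Cor. 8.1.1] -/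
theorem lefschetzPow_map_snd_complexGysin_diagonal (μ : OrientationFamily) (hX : IsSmoothProjective n X)
    (η : complexBetti X 2) (z : complexBetti X 0) (r : ℕ) :
    lefschetzPow (complexBetti.map (snd X X) 2 η) r (2 * n)
        (complexGysin μ hX (Motives.IsSmoothProjective.tensor_holds hX hX) (lift (𝟙 X) (𝟙 X))
          (show 0 + 2 * (n + n) = 2 * n + 2 * n by omega) z) =
      complexGysin μ hX (Motives.IsSmoothProjective.tensor_holds hX hX) (lift (𝟙 X) (𝟙 X))
        (show (0 + 2 * r) + 2 * (n + n) = (2 * n + 2 * r) + 2 * n by omega) (lefschetzPow η r 0 z) := by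
  have hμ : μ.HasPoincareDuality := μ.hasPoincareDuality
  have hXX := Motives.IsSmoothProjective.tensor_holds hX hX
  -- `Δ^* pr₂^* η = η`
  have hpull : complexBetti.map (lift (𝟙 X) (𝟙 X)) 2 (complexBetti.map (snd X X) 2 η) = η := by
    change (complexBetti.map (snd X X) 2 ≫ complexBetti.map (lift (𝟙 X) (𝟙 X)) 2) η = η
    rw [← complexBetti.map_comp, lift_snd, complexBetti.map_id]
    rfl
  induction r with
  | zero => rfl
  | succ r ih =>
    simp only [lefschetzPow_succ, LinearMap.comp_apply, lefschetzOperator_apply]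
    rw [ih, ← complexGysin_cup hμ hX hXX (lift (𝟙 X) (𝟙 X))
      (by omega : 2 + (0 + 2 * r) = 0 + 2 * (r + 1))
      (show (0 + 2 * (r + 1)) + 2 * (n + n) = (2 * n + 2 * (r + 1)) + 2 * n by omega)
      (show (0 + 2 * r) + 2 * (n + n) = (2 * n + 2 * r) + 2 * n by omega)
      (by omega : 2 + (2 * n + 2 * r) = 2 * n + 2 * (r + 1))
      (complexBetti.map (snd X X) 2 η) (lefschetzPow η r 0 z), hpull]

/-- **`(g ⊗ g)_*(Δ_{X*} z) = Δ_{W*}(g_* z)`** for `g : X ⟶ W` (`(g ⊗ g) ∘ Δ_X = Δ_W ∘ g`, functoriality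
of the Gysin morphisms; any orientation family, all typable degrees `k + 2n = kk`, `k + 2m = k' + 2n`,
`k' + 2m = kk'`). [cite: Fulton1998, §16.1 Prop. 16.1.1 (c) (iii)] [cite: FultonYoungTableaux1997, Appendix B §B.1 (2)] -/
theorem complexGysin_tensorHom_complexGysin_diagonal (μ : OrientationFamily) (hX : IsSmoothProjective n X)
    (hW : IsSmoothProjective m W) (g : X ⟶ W) {k kk k' kk' : ℕ} (h1 : k + 2 * n = kk)
    (h2 : k + 2 * m = k' + 2 * n) (h3 : k' + 2 * m = kk') (z : complexBetti X k) :
    complexGysin μ (Motives.IsSmoothProjective.tensor_holds hX hX)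
        (Motives.IsSmoothProjective.tensor_holds hW hW) (g ⊗ₘ g)
        (show kk + 2 * (m + m) = kk' + 2 * (n + n) by omega)
        (complexGysin μ hX (Motives.IsSmoothProjective.tensor_holds hX hX) (lift (𝟙 X) (𝟙 X))
          (show k + 2 * (n + n) = kk + 2 * n by omega) z) =
      complexGysin μ hW (Motives.IsSmoothProjective.tensor_holds hW hW) (lift (𝟙 W) (𝟙 W))
        (show k' + 2 * (m + m) = kk' + 2 * m by omega) (complexGysin μ hX hW g h2 z) := by
  have hμ : μ.HasPoincareDuality := μ.hasPoincareDuality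
  have hXX := Motives.IsSmoothProjective.tensor_holds hX hX
  have hWW := Motives.IsSmoothProjective.tensor_holds hW hW
  rw [← LinearMap.comp_apply, ← complexGysin_comp hμ hX hXX hWW (lift (𝟙 X) (𝟙 X)) (g ⊗ₘ g)
      (show k + 2 * (n + n) = kk + 2 * n by omega)
      (show kk + 2 * (m + m) = kk' + 2 * (n + n) by omega)]
  have hdiag : lift (𝟙 X) (𝟙 X) ≫ (g ⊗ₘ g) = g ≫ lift (𝟙 W) (𝟙 W) := diagonal_comp_tensorHom g
  simp only [hdiag]
  rw [complexGysin_comp hμ hX hW hWW g (lift (𝟙 W) (𝟙 W)) h2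
      (show k' + 2 * (m + m) = kk' + 2 * m by omega), LinearMap.comp_apply]

/-! ### §3 `C(X) ⟹ C(W)` along `g : X ⟶ W` with `g_*(ηʳ) ≠ 0` -/

section Family

variable {r : ℕ} {η : complexBetti X 2} {π : Fin (2 * n + 1) → complexBetti (X ⊗ X) (2 * n)}

/-- **The Künneth decomposition of `cl(Δ_W)` from one of `cl(Δ_X)`, a morphism `g : X ⟶ W` of relative
dimension `r`, and a divisor class `η` with `g_*(L^r_η 1) = c · 1_W`, `c ≠ 0`:** the classes
`c⁻¹ · (g ⊗ g)_*(L^r_{pr₂^*η}(π_X i))`, `i = 0, …, 2m`, lie in the Künneth pieces `H^{2m−i}(W) ⊗ Hⁱ(W)`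
and sum to `cl(Δ_W)` — `Σ_{i ≤ 2n} L^r(π_X i) = L^r(cl(Δ_X)) = Δ_{X*}(L^r_η 1)`, its push-forward is
`Δ_{W*}(g_* L^r_η 1) = c · cl(Δ_W)`, and the members with `i > 2m` vanish (`Hⁱ⁺²ʳ(X(ℂ)) = 0`).
[cite: Kahn2020, §6.9 Lemma 6.30 (2) and its proof] [cite: Kleiman1968AlgebraicCycles, §1–§2] -/
theorem kunnethComponents_diagonalClass_lefschetzPow (hX : IsSmoothProjective n X)
    (hW : IsSmoothProjective m W) (g : X ⟶ W) (hr : m + r = n) {c : ℂ} (hc0 : c ≠ 0)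
    (hc : complexGysin complexOrientationFamily hX hW g (show (0 + 2 * r) + 2 * m = 0 + 2 * n by omega)
      (lefschetzPow η r 0 (singularCohomology.one ℂ (ComplexPoints X))) =
      c • singularCohomology.one ℂ (ComplexPoints W))
    (hπ : ∀ i : Fin (2 * n + 1), π i ∈ kunnethPiece X X (show (2 * n - (i : ℕ)) + i = 2 * n by omega))
    (hΔ : ∑ i, π i = diagonalClass hX) :
    (∀ i : Fin (2 * m + 1),
        c⁻¹ • complexGysin complexOrientationFamily (Motives.IsSmoothProjective.tensor_holds hX hX)
            (Motives.IsSmoothProjective.tensor_holds hW hW) (g ⊗ₘ g)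
            (show (2 * n + 2 * r) + 2 * (m + m) = 2 * m + 2 * (n + n) by omega)
            (lefschetzPow (complexBetti.map (snd X X) 2 η) r (2 * n) (π (Fin.castLE (by omega) i))) ∈
          kunnethPiece W W (show (2 * m - (i : ℕ)) + i = 2 * m by omega)) ∧
      ∑ i : Fin (2 * m + 1),
          c⁻¹ • complexGysin complexOrientationFamily (Motives.IsSmoothProjective.tensor_holds hX hX)
            (Motives.IsSmoothProjective.tensor_holds hW hW) (g ⊗ₘ g)
            (show (2 * n + 2 * r) + 2 * (m + m) = 2 * m + 2 * (n + n) by omega)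
            (lefschetzPow (complexBetti.map (snd X X) 2 η) r (2 * n) (π (Fin.castLE (by omega) i))) =
        diagonalClass hW := by
  have hXX := Motives.IsSmoothProjective.tensor_holds hX hX
  have hWW := Motives.IsSmoothProjective.tensor_holds hW hW
  have hle : 2 * m + 1 ≤ 2 * n + 1 := by omega
  -- the members `L^r(π i')` and their Künneth pieces on `X ⊗ X`
  have hL : ∀ i' : Fin (2 * n + 1),
      lefschetzPow (complexBetti.map (snd X X) 2 η) r (2 * n) (π i') ∈
        kunnethPiece X X (show (2 * n - (i' : ℕ)) + ((i' : ℕ) + 2 * r) = 2 * n + 2 * r by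
          have := i'.isLt; omega) :=
    fun i' ↦ lefschetzPow_map_snd_mem_kunnethPiece η (hπ i') r _ rfl
  refine ⟨fun i ↦ Submodule.smul_mem _ _ ?_, ?_⟩
  · have hi := i.isLt
    exact complexGysin_tensorHom_mem_kunnethPiece_of_cross hX hX hW hW g g
      (p := 2 * n - i) (q := i + 2 * r) (p' := 2 * m - i) (q' := i)
      (by omega) (by omega) (by omega) (by omega) _ (hL (Fin.castLE hle i))
  -- the sum: members of index `> 2m` vanish, and `Σ L^r(π i') = Δ_*(L^r_η 1)`
  set F : Fin (2 * n + 1) → complexBetti (W ⊗ W) (2 * m) := fun i' ↦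
    complexGysin complexOrientationFamily hXX hWW (g ⊗ₘ g)
      (show (2 * n + 2 * r) + 2 * (m + m) = 2 * m + 2 * (n + n) by omega)
      (lefschetzPow (complexBetti.map (snd X X) 2 η) r (2 * n) (π i')) with hF
  have hvan : ∀ i' ∈ (Finset.univ : Finset (Fin (2 * n + 1))),
      i' ∉ (Finset.univ : Finset (Fin (2 * m + 1))).map (Fin.castLEEmb hle) → F i' = 0 := by
    intro i' _ hi'
    have hlt : 2 * m < (i' : ℕ) := by
      by_contra h
      exact hi' (Finset.mem_map.2 ⟨⟨i', by omega⟩, Finset.mem_univ _, Fin.ext rfl⟩)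
    have hi'lt := i'.isLt
    haveI := subsingleton_complexBetti hX (show 2 * n < (i' : ℕ) + 2 * r by omega)
    have h0 : lefschetzPow (complexBetti.map (snd X X) 2 η) r (2 * n) (π i') = 0 := by
      have h := hL i'
      rw [kunnethPiece_eq_bot_of_subsingleton_right (X := X) (Y := X), Submodule.mem_bot] at h
      exact h
    simp only [hF, h0, map_zero]
  rw [← Finset.smul_sum]
  calc c⁻¹ • ∑ i : Fin (2 * m + 1), complexGysin complexOrientationFamily hXX hWW (g ⊗ₘ g)
          (show (2 * n + 2 * r) + 2 * (m + m) = 2 * m + 2 * (n + n) by omega)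
          (lefschetzPow (complexBetti.map (snd X X) 2 η) r (2 * n) (π (Fin.castLE hle i)))
      = c⁻¹ • ∑ i : Fin (2 * m + 1), F (Fin.castLEEmb hle i) := by simp only [hF, Fin.castLEEmb_apply]
    _ = c⁻¹ • ∑ i' ∈ (Finset.univ : Finset (Fin (2 * m + 1))).map (Fin.castLEEmb hle), F i' := by
        rw [Finset.sum_map]
    _ = c⁻¹ • ∑ i' : Fin (2 * n + 1), F i' := by rw [Finset.sum_subset (Finset.subset_univ _) hvan]
    _ = c⁻¹ • complexGysin complexOrientationFamily hXX hWW (g ⊗ₘ g)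
          (show (2 * n + 2 * r) + 2 * (m + m) = 2 * m + 2 * (n + n) by omega)
          (lefschetzPow (complexBetti.map (snd X X) 2 η) r (2 * n) (∑ i', π i')) := by
        simp only [hF, map_sum]
    _ = diagonalClass hW := by
        rw [hΔ, diagonalClass, lefschetzPow_map_snd_complexGysin_diagonal complexOrientationFamily hX η _ r,
          complexGysin_tensorHom_complexGysin_diagonal complexOrientationFamily hX hW g
            (show (0 + 2 * r) + 2 * n = 2 * n + 2 * r by omega)
            (show (0 + 2 * r) + 2 * m = 0 + 2 * n by omega) (show 0 + 2 * m = 2 * m by omega),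
          hc, map_smul, smul_smul, inv_mul_cancel₀ hc0, one_smul]
        rfl

variable {πW : Fin (2 * m + 1) → complexBetti (W ⊗ W) (2 * m)}

/-- **Every Künneth component of `cl(Δ_W)` is `c⁻¹ · (g ⊗ g)_*(L^r_{pr₂^*η}(π_X i))`** (uniqueness of
Künneth decompositions, `kunnethComponents_diagonalClass_unique`). [cite: Kahn2020, §6.9 Lemma 6.30 (2) and its proof]
[cite: Voisin2025, §3.2.1 (14)] -/
theorem kunnethComponent_diagonalClass_eq_smul_complexGysin_lefschetzPow (hX : IsSmoothProjective n X)
    (hW : IsSmoothProjective m W) (g : X ⟶ W) (hr : m + r = n) {c : ℂ} (hc0 : c ≠ 0)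
    (hc : complexGysin complexOrientationFamily hX hW g (show (0 + 2 * r) + 2 * m = 0 + 2 * n by omega)
      (lefschetzPow η r 0 (singularCohomology.one ℂ (ComplexPoints X))) =
      c • singularCohomology.one ℂ (ComplexPoints W))
    (hπ : ∀ i : Fin (2 * n + 1), π i ∈ kunnethPiece X X (show (2 * n - (i : ℕ)) + i = 2 * n by omega))
    (hΔ : ∑ i, π i = diagonalClass hX)
    (hπW : ∀ i : Fin (2 * m + 1), πW i ∈ kunnethPiece W W (show (2 * m - (i : ℕ)) + i = 2 * m by omega))
    (hΔW : ∑ i, πW i = diagonalClass hW) (i : Fin (2 * m + 1)) :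
    πW i = c⁻¹ • complexGysin complexOrientationFamily (Motives.IsSmoothProjective.tensor_holds hX hX)
        (Motives.IsSmoothProjective.tensor_holds hW hW) (g ⊗ₘ g)
        (show (2 * n + 2 * r) + 2 * (m + m) = 2 * m + 2 * (n + n) by omega)
        (lefschetzPow (complexBetti.map (snd X X) 2 η) r (2 * n) (π (Fin.castLE (by omega) i))) := by
  obtain ⟨hρ, hsumρ⟩ := kunnethComponents_diagonalClass_lefschetzPow hX hW g hr hc0 hc hπ hΔ
  exact congrFun (kunnethComponents_diagonalClass_unique hW hπW hΔW hρ hsumρ) i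

/-- **`C(X) ⟹ C(W)` ALONG A MORPHISM `g : X ⟶ W` OF RELATIVE DIMENSION `r` CARRYING A DIVISOR CLASS `η`
WITH `g_*(ηʳ) = c · 1_W`, `c ≠ 0`** (Kahn Lemma 6.30 (2) for the direct summand `h(W)` of `h(X)` cut out
by `c⁻¹ Γ_g ∘ (ηʳ ∪ –) ∘ ᵗΓ_g`): if the Künneth components of `cl(Δ_X)` are algebraic, so is every Künneth
component of every Künneth decomposition of `cl(Δ_W)` — `πW i = c⁻¹ (g ⊗ g)_*(L^r_{pr₂^*η}(π_X i))`, the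
iterated cup product with the divisor class `pr₂^* η` keeps `π_X i` algebraic
(`lefschetzPow_mem_supportedClasses_add`, the divisor case of Voisin II Prop. 9.20 — no moving lemma) and
Gysin morphisms preserve the coniveau (`complexGysin_mem_supportedClasses`).
[cite: Kahn2020, §6.9 Lemma 6.30 (2) and its proof] [cite: Kleiman1968AlgebraicCycles, §1–§2]
[cite: VoisinHodgeII2003, §9.2.4 Prop. 9.20 and Prop. 9.21 (ii)] [cite: Voisin2025, §4.3] -/
theorem kunnethComponent_diagonalClass_mem_algebraicClasses_of_lefschetzPow (hX : IsSmoothProjective n X)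
    (hW : IsSmoothProjective m W) (g : X ⟶ W) (hr : m + r = n) (hη : η ∈ algebraicClasses X 1)
    {c : ℂ} (hc0 : c ≠ 0)
    (hc : complexGysin complexOrientationFamily hX hW g (show (0 + 2 * r) + 2 * m = 0 + 2 * n by omega)
      (lefschetzPow η r 0 (singularCohomology.one ℂ (ComplexPoints X))) =
      c • singularCohomology.one ℂ (ComplexPoints W))
    (hπ : ∀ i : Fin (2 * n + 1), π i ∈ kunnethPiece X X (show (2 * n - (i : ℕ)) + i = 2 * n by omega))
    (hΔ : ∑ i, π i = diagonalClass hX) (hC : ∀ i, π i ∈ algebraicClasses (X ⊗ X) n)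
    (hπW : ∀ i : Fin (2 * m + 1), πW i ∈ kunnethPiece W W (show (2 * m - (i : ℕ)) + i = 2 * m by omega))
    (hΔW : ∑ i, πW i = diagonalClass hW) (i : Fin (2 * m + 1)) :
    πW i ∈ algebraicClasses (W ⊗ W) m := by
  have hXX := Motives.IsSmoothProjective.tensor_holds hX hX
  have hWW := Motives.IsSmoothProjective.tensor_holds hW hW
  rw [kunnethComponent_diagonalClass_eq_smul_complexGysin_lefschetzPow hX hW g hr hc0 hc hπ hΔ hπW hΔW i]
  refine Submodule.smul_mem _ _ ?_
  -- `L^r_{pr₂^*η}(π_X i) ∈ N^{n+r} H^{2n+2r}((X ⊗ X)(ℂ))`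
  have hL : lefschetzPow (complexBetti.map (snd X X) 2 η) r (2 * n) (π (Fin.castLE (by omega) i)) ∈
      supportedClasses (X ⊗ X) (2 * n + 2 * r) (n + r) :=
    lefschetzPow_mem_supportedClasses_add hXX (map_snd_mem_supportedClasses hX hX hη) (hC _) r
  exact complexGysin_mem_supportedClasses (gysinMap_restrictCompl_eq_zero_of_field ℂ)
    complexOrientationFamily hasPoincareDuality_complexOrientationFamily hXX hWW (g ⊗ₘ g) _
    (r := n + r) (s := m) (by omega) hL

/-- **`C(X) ⟹ C(W)` along `g : X ⟶ W` with `g_*(ηʳ) ≠ 0`** for a divisor class `η` on `X` (`dim X = dim W + r`;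
the degree-`0` class `g_*(L^r_η 1) ∈ H⁰(W(ℂ)) = ℂ · 1` is then a non-zero multiple of `1`).
[cite: Kahn2020, §6.9 Lemma 6.30 (2)] [cite: Kleiman1968AlgebraicCycles, §1–§2] -/
theorem kunnethComponent_diagonalClass_mem_algebraicClasses_of_lefschetzPow_ne_zero
    (hX : IsSmoothProjective n X) (hW : IsSmoothProjective m W) (g : X ⟶ W) (hr : m + r = n)
    (hη : η ∈ algebraicClasses X 1)
    (hne : complexGysin complexOrientationFamily hX hW g (show (0 + 2 * r) + 2 * m = 0 + 2 * n by omega)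
      (lefschetzPow η r 0 (singularCohomology.one ℂ (ComplexPoints X))) ≠ 0)
    (hπ : ∀ i : Fin (2 * n + 1), π i ∈ kunnethPiece X X (show (2 * n - (i : ℕ)) + i = 2 * n by omega))
    (hΔ : ∑ i, π i = diagonalClass hX) (hC : ∀ i, π i ∈ algebraicClasses (X ⊗ X) n)
    (hπW : ∀ i : Fin (2 * m + 1), πW i ∈ kunnethPiece W W (show (2 * m - (i : ℕ)) + i = 2 * m by omega))
    (hΔW : ∑ i, πW i = diagonalClass hW) (i : Fin (2 * m + 1)) :
    πW i ∈ algebraicClasses (W ⊗ W) m := by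
  obtain ⟨c, hc⟩ := exists_eq_smul_one complexOrientationFamily hW
    (complexGysin complexOrientationFamily hX hW g (show (0 + 2 * r) + 2 * m = 0 + 2 * n by omega)
      (lefschetzPow η r 0 (singularCohomology.one ℂ (ComplexPoints X))))
  have hc0 : c ≠ 0 := by
    rintro rfl
    exact hne (by rw [hc, zero_smul])
  exact kunnethComponent_diagonalClass_mem_algebraicClasses_of_lefschetzPow hX hW g hr hη hc0 hc hπ hΔ hC
    hπW hΔW i

end Family

/-- **`C(X) ⟹ C(W)` along `g : X ⟶ W` with a divisor class `η` on `X`, `g_*(ηʳ) ≠ 0`, family-free form**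
(`dim X = dim W + r`; Künneth decompositions of `cl(Δ_X)` exist, `nonempty_kunnethComponents_diagonalClass`).
[cite: Kahn2020, §6.9 Lemma 6.30 (2)] [cite: Kleiman1968AlgebraicCycles, §1–§2] -/
theorem kunnethComponent_diagonalClass_mem_algebraicClasses_of_lefschetzPow_ne_zero_of_forall
    (hX : IsSmoothProjective n X) (hW : IsSmoothProjective m W) (g : X ⟶ W) {r : ℕ} (hr : m + r = n)
    {η : complexBetti X 2} (hη : η ∈ algebraicClasses X 1)
    (hne : complexGysin complexOrientationFamily hX hW g (show (0 + 2 * r) + 2 * m = 0 + 2 * n by omega)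
      (lefschetzPow η r 0 (singularCohomology.one ℂ (ComplexPoints X))) ≠ 0)
    (hCX : ∀ (πX : Fin (2 * n + 1) → complexBetti (X ⊗ X) (2 * n)),
      (∀ i : Fin (2 * n + 1), πX i ∈ kunnethPiece X X (show (2 * n - (i : ℕ)) + i = 2 * n by omega)) →
      ∑ i, πX i = diagonalClass hX → ∀ i, πX i ∈ algebraicClasses (X ⊗ X) n)
    {πW : Fin (2 * m + 1) → complexBetti (W ⊗ W) (2 * m)}
    (hπW : ∀ i : Fin (2 * m + 1), πW i ∈ kunnethPiece W W (show (2 * m - (i : ℕ)) + i = 2 * m by omega))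
    (hΔW : ∑ i, πW i = diagonalClass hW) (i : Fin (2 * m + 1)) :
    πW i ∈ algebraicClasses (W ⊗ W) m := by
  obtain ⟨⟨πX, hπX, hΔX⟩⟩ := nonempty_kunnethComponents_diagonalClass hX
  exact kunnethComponent_diagonalClass_mem_algebraicClasses_of_lefschetzPow_ne_zero hX hW g hr hη hne hπX
    hΔX (hCX πX hπX hΔX) hπW hΔW i

end Literature.AlgebraicGeometry.HodgeTheory

end
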